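/-
Fleet lead `ym-wcr-19609-p1` (seat prover-ym-wcr-19609-p1-g2-0), route `WeakCouplingRates`, crux `BulkDominatesColdBoxW`
(stmt-QuantumFields-19609), line `dlr-chessboard` (v4), brick M3 (interior bounds) of the census v3 (item evidence #12).
-/
import Summits.QuantumFields.YangMills.Theorems.WeakCouplingRatesBulkDominatesColdBoxWDatumBackground
import Literature.MathematicalPhysics.QuantumFieldTheory.Balaban1983to89.Beta.PoissonInterior

/-!
# Crux `BulkDominatesColdBoxW`, stubs L1a/L1b: INTERIOR SUP AND GRADIENT BOUNDS for the background of a boundary datum, from its energy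

Census v3 of the line `dlr-chessboard` (item evidence #12): the background circulation `F̄ = d₁ ψ̄` of a Dirichlet datum `θ`
(`ψ̄` = the glued edge function of `θ` and the mean shift `LatticeMaxwell.mean … θ`, file `…DatumBackground`) has
`latticeLaplacianZd`-harmonic components inside the cold box `{0,…,2H}⁴` (`latticeLaplacianZd_dirBackground_eq_zero_of_coords`) and energy
`Σ_p F̄_p² ≤ M_θ(s)` for every free competitor `s` (`sum_dirBackground_sq_le_formM`).  Feeding these two facts into the tree's interior
estimate for the lattice Poisson equation (`Beta.PoissonInterior.interior_estimate`, d = 4, source `A = 0`, ℓ¹-size `B` on a cube of radius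
`3⌊H/4⌋` bounded by Cauchy–Schwarz through the energy) gives, for every base point `x` within `H/8` of the centre `(H,H,H,H)` (sup norm),
every pair of directions and every competitor `s`:

  `|F̄(x; k, l)| ≤ C · M_θ(s)^{1/2} / H²`   and   `|F̄(x + e_j; k, l) − F̄(x; k, l)| ≤ C · M_θ(s)^{1/2} / H³`   (`H ≥ 8`)

with ONE constant `C` (`dirBackground_interior_bounds`).  In the line's bookkeeping (crude-good datum of scale `β^{2δ−1}`, competitor = the
datum's own forest-gauged chart coordinates, `M_θ(s) ≲ H⁴β^{2δ−1}`) this is `|F̄| ≲ β^{δ−1/2}` and `|∇F̄| ≲ β^{δ−1/2}/H` at depth `≍ H` — the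
two inputs of `stub_goodBoundaryMeanSmooth` (L1b) and of the sign control in `stub_goodBoundaryCovStable` (L1a).
No new definition; standard axioms.  NOT a claim about the mass gap.
-/

set_option autoImplicit false

noncomputable section

open Finset Matrix
open Literature.Probability.LatticeModels
open Literature.MathematicalPhysics.QuantumLattice
open Literature.MathematicalPhysics.QuantumFieldTheory
open Literature.MathematicalPhysics.QuantumFieldTheory.LatticeMaxwell
open Literature.MathematicalPhysics.QuantumFieldTheory.AxialGauge
open Literature.MathematicalPhysics.QuantumFieldTheory.LatticeChain
open Literature.MathematicalPhysics.QuantumFieldTheory.LatticeForm (e d₀ d₁ d₂ d₁_d₀ d₂_d₁ d₁_swap d₁_sub)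
open Literature.MathematicalPhysics.QuantumFieldTheory.Balaban1983to89.Beta.PoissonInterior (cube mem_cube interior_estimate)

namespace Summit.QuantumFields.YangMills.Theorems.WeakCouplingRates

variable (H : ℕ) (θ : Literature.MathematicalPhysics.QuantumLattice.ZdEdge 4 → ℝ)

/-! ## The energy controls the ℓ² (hence ℓ¹) size of each component on an inner cube -/

/-- A positively oriented plaquette whose base point has all coordinates in `[−1, 2H]` is (the shift of) a plaquette label of the
enlarged box `{0,…,2H+2}⁴ + dirCorner`. -/
theorem sub_dirCorner_mem_plaquettesIn {H : ℕ} {z : Site 4} {i j : Fin 4} (hij : i < j)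
    (hz : ∀ m : Fin 4, -1 ≤ z m ∧ z m ≤ 2 * (H : ℤ)) :
    ((z - dirCorner, i, j) : Plaq 4) ∈ plaquettesIn (halfOpenBox 4 (2 * H + 3)) := by
  rw [Plaq.mem_plaquettesIn]
  refine ⟨?_, hij, ?_, ?_, ?_⟩ <;> rw [mem_halfOpenBox] <;> intro m <;> have := hz m
  · simp only [Pi.sub_apply, dirCorner]; push_cast; omega
  · simp only [Pi.add_apply, Pi.sub_apply, dirCorner, Pi.single_apply]; push_cast; split_ifs <;> omega
  · simp only [Pi.add_apply, Pi.sub_apply, dirCorner, Pi.single_apply]; push_cast; split_ifs <;> omega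
  · simp only [Pi.add_apply, Pi.sub_apply, dirCorner, Pi.single_apply]; push_cast; split_ifs <;> omega

/-- **The energy dominates every component on an inner region**: for a finite set `S` of base points with coordinates in `[−1, 2H]`,
`Σ_{y ∈ S} F̄(y; k, l)² ≤ Σ_p F̄_{a+p}²` (each base point contributes one plaquette of the enlarged box, or zero when `k = l`). -/
theorem sum_dirBackground_sq_le_energy (S : Finset (Site 4)) (hS : ∀ y ∈ S, ∀ m : Fin 4, -1 ≤ y m ∧ y m ≤ 2 * (H : ℤ))
    (k l : Fin 4) :
    ∑ y ∈ S, d₁ (fun x (i : Fin 4) =>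
        LatticeMaxwell.glue (pin := fun e => e ∉ dirFreeEdges H) dirCorner (2 * H + 3) θ
          (mean (fun e => e ∉ dirFreeEdges H) dirCorner (2 * H + 3) θ) (x, i)) y k l ^ 2 ≤
      ∑ p ∈ plaquettesIn (halfOpenBox 4 (2 * H + 3)),
        sCirc (LatticeMaxwell.glue (pin := fun e => e ∉ dirFreeEdges H) dirCorner (2 * H + 3) θ
          (mean (fun e => e ∉ dirFreeEdges H) dirCorner (2 * H + 3) θ)) (Plaq.shift dirCorner p) ^ 2 := by
  set ψ : Site 4 → Fin 4 → ℝ := fun x i =>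
    LatticeMaxwell.glue (pin := fun e => e ∉ dirFreeEdges H) dirCorner (2 * H + 3) θ
      (mean (fun e => e ∉ dirFreeEdges H) dirCorner (2 * H + 3) θ) (x, i) with hψ
  have hcirc : ∀ p : Plaq 4, sCirc (LatticeMaxwell.glue (pin := fun e => e ∉ dirFreeEdges H) dirCorner (2 * H + 3) θ
      (mean (fun e => e ∉ dirFreeEdges H) dirCorner (2 * H + 3) θ)) p = d₁ ψ p.1 p.2.1 p.2.2 := fun p => sCirc_eq_d₁ _ p
  simp_rw [hcirc]
  -- the oriented case
  have horiented : ∀ i j : Fin 4, i < j →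
      ∑ y ∈ S, d₁ ψ y i j ^ 2 ≤ ∑ p ∈ plaquettesIn (halfOpenBox 4 (2 * H + 3)),
        d₁ ψ (Plaq.shift dirCorner p).1 (Plaq.shift dirCorner p).2.1 (Plaq.shift dirCorner p).2.2 ^ 2 := by
    intro i j hij
    set f : Site 4 → Plaq 4 := fun y => ((y - dirCorner, i, j) : Plaq 4) with hf
    have hinj : Set.InjOn f S := by
      intro y _ y' _ h
      simp only [hf, Prod.mk.injEq] at h
      exact sub_left_injective h.1
    have hsub : S.image f ⊆ plaquettesIn (halfOpenBox 4 (2 * H + 3)) := by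
      intro p hp
      obtain ⟨y, hy, rfl⟩ := Finset.mem_image.1 hp
      exact sub_dirCorner_mem_plaquettesIn hij (hS y hy)
    have hval : ∀ y, d₁ ψ (Plaq.shift dirCorner (f y)).1 (Plaq.shift dirCorner (f y)).2.1 (Plaq.shift dirCorner (f y)).2.2 =
        d₁ ψ y i j := fun y => by simp [hf, Plaq.shift]
    calc ∑ y ∈ S, d₁ ψ y i j ^ 2
        = ∑ y ∈ S, d₁ ψ (Plaq.shift dirCorner (f y)).1 (Plaq.shift dirCorner (f y)).2.1 (Plaq.shift dirCorner (f y)).2.2 ^ 2 :=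
          Finset.sum_congr rfl fun y _ => by rw [hval]
      _ = ∑ p ∈ S.image f, d₁ ψ (Plaq.shift dirCorner p).1 (Plaq.shift dirCorner p).2.1 (Plaq.shift dirCorner p).2.2 ^ 2 := by
          rw [Finset.sum_image hinj]
      _ ≤ _ := Finset.sum_le_sum_of_subset_of_nonneg hsub fun p _ _ => sq_nonneg _
  rcases lt_trichotomy k l with hkl | rfl | hkl
  · exact horiented k l hkl
  · simp only [LatticeForm.d₁_self]
    simp only [ne_eq, OfNat.ofNat_ne_zero, not_false_eq_true, zero_pow, Finset.sum_const_zero]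
    exact Finset.sum_nonneg fun p _ => sq_nonneg _
  · have hswap : ∀ y, d₁ ψ y k l ^ 2 = d₁ ψ y l k ^ 2 := fun y => by rw [d₁_swap ψ y l k, neg_sq]
    simp_rw [hswap]
    exact horiented l k hkl

/-- The cardinality of a sup-norm cube of radius `R` in `ℤ⁴` is `(2R+1)⁴`. -/
theorem card_cube_four (c : Site 4) (R : ℕ) : (cube c R).card = (2 * R + 1) ^ 4 := by
  unfold cube
  rw [Fintype.card_piFinset]
  have h : ∀ i : Fin 4, (Finset.Icc (c i - R) (c i + R)).card = 2 * R + 1 := fun i => by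
    rw [Int.card_Icc]; omega
  rw [Finset.prod_congr rfl fun i _ => h i, Finset.prod_const, Finset.card_univ, Fintype.card_fin]

/-! ## The interior bounds -/

/-- **Interior sup and gradient bounds of the background of a datum, from its energy.**  There is an absolute constant `C` such that
for every `H ≥ 8`, every datum `θ`, every free competitor `s`, every base point `x` with `8·|x_m − H| ≤ H` for all `m` (within `H/8` of the
centre of the cold box `{0,…,2H}⁴` in sup norm), and all directions `k, l`:
`|F̄(x; k, l)| ≤ C · M_θ(s)^{1/2} / H²` and `|F̄(x+e_j; k, l) − F̄(x; k, l)| ≤ C · M_θ(s)^{1/2} / H³` for every `j`,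
where `F̄ = d₁ ψ̄` is the background circulation of `θ` and `M_θ = LatticeMaxwell.formM (· ∉ dirFreeEdges H) dirCorner (2H+3) θ`.
Proof: `interior_estimate` (d = 4, `A = 0` by `latticeLaplacianZd_dirBackground_eq_zero_of_coords`, `m = ⌊H/4⌋`, ℓ¹ size on
`cube x (3m)` at most `(6m+1)²·M_θ(s)^{1/2}` by Cauchy–Schwarz and `sum_dirBackground_sq_le_energy` + `sum_dirBackground_sq_le_formM`). -/
theorem dirBackground_interior_bounds :
    ∃ C : ℝ, 0 ≤ C ∧ ∀ (H : ℕ), 8 ≤ H →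
      ∀ (θ : Literature.MathematicalPhysics.QuantumLattice.ZdEdge 4 → ℝ) (s : DirFree H → ℝ) (x : Site 4),
        (∀ m : Fin 4, 8 * |x m - H| ≤ (H : ℤ)) → ∀ k l : Fin 4,
          |d₁ (fun z (i : Fin 4) =>
              LatticeMaxwell.glue (pin := fun e => e ∉ dirFreeEdges H) dirCorner (2 * H + 3) θ
                (mean (fun e => e ∉ dirFreeEdges H) dirCorner (2 * H + 3) θ) (z, i)) x k l| ≤
            C * Real.sqrt (formM (fun e => e ∉ dirFreeEdges H) dirCorner (2 * H + 3) θ s) / (H : ℝ) ^ 2 ∧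
          ∀ j : Fin 4,
            |d₁ (fun z (i : Fin 4) =>
                LatticeMaxwell.glue (pin := fun e => e ∉ dirFreeEdges H) dirCorner (2 * H + 3) θ
                  (mean (fun e => e ∉ dirFreeEdges H) dirCorner (2 * H + 3) θ) (z, i)) (x + Pi.single j 1) k l -
              d₁ (fun z (i : Fin 4) =>
                LatticeMaxwell.glue (pin := fun e => e ∉ dirFreeEdges H) dirCorner (2 * H + 3) θ
                  (mean (fun e => e ∉ dirFreeEdges H) dirCorner (2 * H + 3) θ) (z, i)) x k l| ≤
            C * Real.sqrt (formM (fun e => e ∉ dirFreeEdges H) dirCorner (2 * H + 3) θ s) / (H : ℝ) ^ 3 := by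
  obtain ⟨C, hC, hI⟩ := interior_estimate (d := 4) (by norm_num)
  refine ⟨25088 * C, by positivity, fun H hH θ s x hx k l => ?_⟩
  set ψ : Site 4 → Fin 4 → ℝ := fun z i =>
    LatticeMaxwell.glue (pin := fun e => e ∉ dirFreeEdges H) dirCorner (2 * H + 3) θ
      (mean (fun e => e ∉ dirFreeEdges H) dirCorner (2 * H + 3) θ) (z, i) with hψ
  set u : Site 4 → ℝ := fun z => d₁ ψ z k l with hu
  set E : ℝ := formM (fun e => e ∉ dirFreeEdges H) dirCorner (2 * H + 3) θ s with hE
  set m : ℕ := H / 4 with hm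
  have hm1 : 1 ≤ m := by omega
  have hm4 : 4 * m ≤ H := Nat.mul_div_le H 4
  have hHm : H ≤ 8 * m := by omega
  -- every point of the cube `cube x (3m)` has coordinates in `[0, 2H−1]`
  have hcoords : ∀ y ∈ cube x (3 * m), ∀ i : Fin 4, 0 ≤ y i ∧ y i ≤ 2 * (H : ℤ) - 1 := by
    intro y hy i
    have h1 := (mem_cube.1 hy) i
    have h2 := hx i
    have h2a := le_abs_self (x i - H)
    have h2b := neg_abs_le (x i - H)
    rw [abs_le] at h1
    push_cast at h1
    have h3 : (4 * m : ℤ) ≤ H := by exact_mod_cast hm4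
    have h8 : (8 : ℤ) ≤ H := by exact_mod_cast hH
    constructor <;> omega
  -- harmonicity on the cube
  have hA : ∀ y ∈ cube x (3 * m), |latticeLaplacianZd u y| ≤ 0 := by
    intro y hy
    rw [hu, latticeLaplacianZd_dirBackground_eq_zero_of_coords H θ k l (hcoords y hy), abs_zero]
  -- energy ≥ ℓ² on the cube ≥ (ℓ¹)² / #cube
  have hE0 : 0 ≤ E := by
    rw [hE, formM]; exact Finset.sum_nonneg fun p _ => sq_nonneg _
  have hl2 : ∑ y ∈ cube x (3 * m), u y ^ 2 ≤ E := by
    refine (sum_dirBackground_sq_le_energy H θ (cube x (3 * m)) (fun y hy i => ?_) k l).trans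
      (sum_dirBackground_sq_le_formM H θ s)
    have := hcoords y hy i
    constructor <;> omega
  have hcard : ((cube x (3 * m)).card : ℝ) = (((6 * m + 1 : ℕ) : ℝ) ^ 2) ^ 2 := by
    rw [card_cube_four]; push_cast; ring
  have hB : ∑ y ∈ cube x (3 * m), |u y| ≤ ((6 * m + 1 : ℕ) : ℝ) ^ 2 * Real.sqrt E := by
    have hcs := Real.sum_mul_le_sqrt_mul_sqrt (cube x (3 * m)) (fun _ => (1 : ℝ)) (fun y => |u y|)
    simp only [one_mul, one_pow, Finset.sum_const, nsmul_eq_mul, mul_one, sq_abs] at hcs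
    have hN : (0 : ℝ) ≤ ((6 * m + 1 : ℕ) : ℝ) ^ 2 := by positivity
    rw [hcard, Real.sqrt_sq hN] at hcs
    exact hcs.trans (mul_le_mul_of_nonneg_left (Real.sqrt_le_sqrt hl2) hN)
  obtain ⟨hval, hgrad⟩ := hI m hm1 u x 0 (((6 * m + 1 : ℕ) : ℝ) ^ 2 * Real.sqrt E) hA hB
  -- arithmetic: `(6m+1)² ≤ 49 m²`, `H ≤ 8m`
  have hm0 : (0 : ℝ) < m := by exact_mod_cast hm1
  have hmR : (1 : ℝ) ≤ m := by exact_mod_cast hm1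
  have hHR : (H : ℝ) ≤ 8 * m := by exact_mod_cast hHm
  have hH8 : (8 : ℝ) ≤ H := by exact_mod_cast hH
  have hH0 : (0 : ℝ) < H := by linarith
  have h49 : ((6 * m + 1 : ℕ) : ℝ) ^ 2 ≤ 49 * (m : ℝ) ^ 2 := by push_cast; nlinarith
  have hsE := Real.sqrt_nonneg E
  have hkey2 : ((6 * m + 1 : ℕ) : ℝ) ^ 2 * Real.sqrt E / (m : ℝ) ^ 4 ≤ 3136 * Real.sqrt E / (H : ℝ) ^ 2 := by
    rw [div_le_div_iff₀ (by positivity) (by positivity)]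
    have h1 : (H : ℝ) ^ 2 ≤ 64 * (m : ℝ) ^ 2 := by nlinarith
    calc ((6 * m + 1 : ℕ) : ℝ) ^ 2 * Real.sqrt E * (H : ℝ) ^ 2
        ≤ (49 * (m : ℝ) ^ 2) * Real.sqrt E * (64 * (m : ℝ) ^ 2) := by gcongr
      _ = 3136 * Real.sqrt E * (m : ℝ) ^ 4 := by ring
  have hkey3 : ((6 * m + 1 : ℕ) : ℝ) ^ 2 * Real.sqrt E / (m : ℝ) ^ (4 + 1) ≤ 25088 * Real.sqrt E / (H : ℝ) ^ 3 := by
    rw [div_le_div_iff₀ (by positivity) (by positivity)]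
    have h1 : (H : ℝ) ^ 3 ≤ 512 * (m : ℝ) ^ 3 := by
      have := pow_le_pow_left₀ hH0.le hHR 3
      nlinarith
    calc ((6 * m + 1 : ℕ) : ℝ) ^ 2 * Real.sqrt E * (H : ℝ) ^ 3
        ≤ (49 * (m : ℝ) ^ 2) * Real.sqrt E * (512 * (m : ℝ) ^ 3) := by gcongr
      _ = 25088 * Real.sqrt E * (m : ℝ) ^ (4 + 1) := by ring
  constructor
  · calc |u x| ≤ C * ((m : ℝ) ^ 2 * 0 + ((6 * m + 1 : ℕ) : ℝ) ^ 2 * Real.sqrt E / (m : ℝ) ^ 4) := hval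
      _ = C * (((6 * m + 1 : ℕ) : ℝ) ^ 2 * Real.sqrt E / (m : ℝ) ^ 4) := by ring
      _ ≤ C * (3136 * Real.sqrt E / (H : ℝ) ^ 2) := mul_le_mul_of_nonneg_left hkey2 hC
      _ ≤ 25088 * C * Real.sqrt E / (H : ℝ) ^ 2 := by
          rw [mul_div_assoc, mul_div_assoc]
          have : 0 ≤ Real.sqrt E / (H : ℝ) ^ 2 := by positivity
          nlinarith
  · intro j
    calc |u (x + Pi.single j 1) - u x| ≤ C * ((m : ℝ) * 0 + ((6 * m + 1 : ℕ) : ℝ) ^ 2 * Real.sqrt E / (m : ℝ) ^ (4 + 1)) :=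
          hgrad j
      _ = C * (((6 * m + 1 : ℕ) : ℝ) ^ 2 * Real.sqrt E / (m : ℝ) ^ (4 + 1)) := by ring
      _ ≤ C * (25088 * Real.sqrt E / (H : ℝ) ^ 3) := mul_le_mul_of_nonneg_left hkey3 hC
      _ = 25088 * C * Real.sqrt E / (H : ℝ) ^ 3 := by ring

end Summit.QuantumFields.YangMills.Theorems.WeakCouplingRates

end
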